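import Summits.Ventures.PercRepro.C025ProfilePLDUniformTable_r10_s6_m12A
import Summits.Ventures.PercRepro.C025ProfilePLDUniformTable_r10_s6_m12B
import Summits.Ventures.PercRepro.C025ProfilePLDUniformTable_r10_s6_m12C
import Summits.Ventures.PercRepro.C025ProfilePLDUniformTable_r10_s6_m12D
import Summits.Ventures.PercRepro.C025ProfilePLDUniformTable_r10_s6_m12E
import Summits.Ventures.PercRepro.C025ProfilePLDUniformTable_r10_s6_m12F
import Summits.Ventures.PercRepro.C025ProfilePLDUniformTable_r10_s6_m12G
import Summits.Ventures.PercRepro.C025ProfilePLDUniformTable_r10_s6_m12H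
import Summits.Ventures.PercRepro.C025ProfilePLDUniformTable_r10_s6_m12I
import Summits.Ventures.PercRepro.C025ProfilePLDUniformTable_r10_s6_m12J
import Summits.Ventures.PercRepro.C025ProfilePLDUniformTable_r10_s6_m12K
import Summits.Ventures.PercRepro.C025ProfilePLDUniformTable_r10_s6_m12L
import Summits.Ventures.PercRepro.C025ProfilePLDUniformTable_r10_s6_m12M
import Summits.Ventures.PercRepro.C025ProfilePLDUniformTable_r10_s6_m12N
import Summits.Ventures.PercRepro.C025ProfilePLDUniformTable_r10_s6_m12O
import Summits.Ventures.PercRepro.C025ProfilePLDUniformTable_r10_s6_m12P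
import Summits.Ventures.PercRepro.C025ProfilePLDSixLiftArithNine
import Summits.Ventures.PercRepro.C025ProfilePLDSixTable10a
import Summits.Ventures.PercRepro.C025ProfilePLDSixTable10b
import Summits.Ventures.PercRepro.C025ProfilePLDSixTable10c
import Summits.Ventures.PercRepro.C025ProfilePLDSixTable10d

/-!
# (PLD) FOR «M ⊕ U_{6,m}» FOR EVERY m ≥ 12 AND EVERY (PLD)-MATROID M OF RANK ≤ 10: THE CERTIFICATE TABLE FOR U_{6,12} LIFTED IN m (night-3 g35)

`proofs/NIGHT3-G35-BASEMAP.md` §2 (the fast engine of g34, `proofs/NIGHT3-G34-FASTLIFT.md` §1).  The profile of `U_{6,m}` has 13 layers (`sum_choose_min_six`, `m ≥ 12`); `T56` and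
`δ66` preserve PER-LAYER DOMINANCE (g29), the joint-LP preservers q₆ = T₁₆+3T₂₆+6T₃₆+9T₄₆+11T₅₆, q₆′ = T₂₆+2T₃₆+3T₄₆+4T₅₆, q₆″ = T₃₆+2T₄₆+3T₅₆, q₆‴ = T₄₆+3T₅₆ (unchanged from rank 9 to rank 10: kit j331389) do at rank ≤ 10 (`PLDPlaneTable.pld_conv_q61_of_eRank_le_10`, …,
`pld_conv_q64n_of_eRank_le_10`), and the base-12 identity 120·(U_{6,12+k} − U_{6,12}) = 120k q₆ + k(1020+60k) q₆′ + k(4480+540k+20k²) q₆″ + k(9790+2035k+170k²+5k³) q₆‴ + k(294+1885k+425k²+35k³+k⁴) T₅₆ + 120Δc δ₆₆ (`lift_instance_six_nine`): ONE certificate table — the landed `uniform_6_12_table_10` for `M ⊕ U_{6,12}` at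
rank ≤ 10 — gives (PLD) for `M ⊕ U_{6,m}` for EVERY `m ≥ 12` (`pld_disjointSum_uniform_six_ge_12_of_eRank_le_10`).  No `def`, no `instance`, no notation.  Axioms: standard.
-/

open scoped Matroid

namespace PercRepro

open Finset ThmH

namespace PLDSixLift

variable {α : Type} [DecidableEq α]

/-- (PLD) FOR «M ⊕ U_{6,m}» FOR EVERY `m ≥ 12` AND EVERY (PLD)-MATROID `M` OF RANK ≤ 10: the uniform matroid is
`truncate (freeOn F) 6` with `|F| = m ≥ 12`. -/
theorem pld_disjointSum_uniform_six_ge_12_of_eRank_le_10 (M : Matroid α) [M.Finite] (hr : M.eRank ≤ 10)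
    (hPLD : ∀ lo hi δ Θ : ℕ, Θ ≤ lo + hi + δ → (lo = 0 ∨ lo + hi + δ ≤ Θ) →
      (∑ I ∈ (gr M).powerset, (if lo ≤ (M.eRk (I : Set α)).toNat ∧ (M.eRk (I : Set α)).toNat ≤ hi ∧
          Θ ≤ (M.eRk ((gr M \ I : Finset α) : Set α)).toNat + (M.eRk (I : Set α)).toNat then
          ((M.eRk ((gr M \ I : Finset α) : Set α)).toNat).choose δ else 0)) ≤
        ∑ I ∈ (gr M).powerset, (if lo + δ ≤ (M.eRk ((gr M \ I : Finset α) : Set α)).toNat ∧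
          (M.eRk ((gr M \ I : Finset α) : Set α)).toNat ≤ hi + δ then
          ((M.eRk ((gr M \ I : Finset α) : Set α)).toNat).choose δ else 0))
    (F : Finset α) (hF : 12 ≤ F.card)
    (h : Disjoint M.E (@Matroid.truncate α (Matroid.freeOn (F : Set α)) (PLDTruncate.freeOn_finite' F) 6).E) :
    haveI := PLDTruncate.freeOn_finite' F
    haveI := PLDClosure.disjointSum_finite' _ _ h
    ∀ lo hi δ Θ : ℕ, Θ ≤ lo + hi + δ → (lo = 0 ∨ lo + hi + δ ≤ Θ) →
      (∑ I ∈ (gr (M.disjointSum (Matroid.truncate (Matroid.freeOn (F : Set α)) 6) h)).powerset, (if lo ≤ ((M.disjointSum (Matroid.truncate (Matroid.freeOn (F : Set α)) 6) h).eRk (I : Set α)).toNat ∧ ((M.disjointSum (Matroid.truncate (Matroid.freeOn (F : Set α)) 6) h).eRk (I : Set α)).toNat ≤ hi ∧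
          Θ ≤ ((M.disjointSum (Matroid.truncate (Matroid.freeOn (F : Set α)) 6) h).eRk ((gr (M.disjointSum (Matroid.truncate (Matroid.freeOn (F : Set α)) 6) h) \ I : Finset α) : Set α)).toNat + ((M.disjointSum (Matroid.truncate (Matroid.freeOn (F : Set α)) 6) h).eRk (I : Set α)).toNat then
          (((M.disjointSum (Matroid.truncate (Matroid.freeOn (F : Set α)) 6) h).eRk ((gr (M.disjointSum (Matroid.truncate (Matroid.freeOn (F : Set α)) 6) h) \ I : Finset α) : Set α)).toNat).choose δ else 0)) ≤
        ∑ I ∈ (gr (M.disjointSum (Matroid.truncate (Matroid.freeOn (F : Set α)) 6) h)).powerset, (if lo + δ ≤ ((M.disjointSum (Matroid.truncate (Matroid.freeOn (F : Set α)) 6) h).eRk ((gr (M.disjointSum (Matroid.truncate (Matroid.freeOn (F : Set α)) 6) h) \ I : Finset α) : Set α)).toNat ∧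
          ((M.disjointSum (Matroid.truncate (Matroid.freeOn (F : Set α)) 6) h).eRk ((gr (M.disjointSum (Matroid.truncate (Matroid.freeOn (F : Set α)) 6) h) \ I : Finset α) : Set α)).toNat ≤ hi + δ then
          (((M.disjointSum (Matroid.truncate (Matroid.freeOn (F : Set α)) 6) h).eRk ((gr (M.disjointSum (Matroid.truncate (Matroid.freeOn (F : Set α)) 6) h) \ I : Finset α) : Set α)).toNat).choose δ else 0) := by
  haveI := PLDTruncate.freeOn_finite' F
  haveI := PLDClosure.disjointSum_finite' _ _ h
  have hU : (Matroid.truncate (Matroid.freeOn (F : Set α)) 6).eRank ≤ ((6 : ℕ) : ℕ∞) := by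
    rw [Matroid.truncate_eRank]; exact min_le_right _ _
  have hr' : M.eRank ≤ ((10 : ℕ) : ℕ∞) := by exact_mod_cast hr
  have hb : ∀ I ∈ (gr (M.disjointSum (Matroid.truncate (Matroid.freeOn (F : Set α)) 6) h)).powerset,
      ((M.disjointSum (Matroid.truncate (Matroid.freeOn (F : Set α)) 6) h).eRk (I : Set α)).toNat ≤ 16 ∧ ((M.disjointSum (Matroid.truncate (Matroid.freeOn (F : Set α)) 6) h).eRk ((gr (M.disjointSum (Matroid.truncate (Matroid.freeOn (F : Set α)) 6) h) \ I : Finset α) : Set α)).toNat ≤ 16 := by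
    intro I _
    constructor
    · rw [PLDClosure.toNat_eRk_disjointSum]
      have h1 := PLDCert.toNat_eRk_le_of_eRank_le M hr' ((I ∩ gr M : Finset α) : Set α)
      have h2 := PLDCert.toNat_eRk_le_of_eRank_le _ hU ((I ∩ gr (Matroid.truncate (Matroid.freeOn (F : Set α)) 6) : Finset α) : Set α)
      omega
    · rw [PLDClosure.toNat_eRk_disjointSum]
      have h1 := PLDCert.toNat_eRk_le_of_eRank_le M hr' (((gr (M.disjointSum (Matroid.truncate (Matroid.freeOn (F : Set α)) 6) h) \ I) ∩ gr M : Finset α) : Set α)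
      have h2 := PLDCert.toNat_eRk_le_of_eRank_le _ hU (((gr (M.disjointSum (Matroid.truncate (Matroid.freeOn (F : Set α)) 6) h) \ I) ∩ gr (Matroid.truncate (Matroid.freeOn (F : Set α)) 6) : Finset α) : Set α)
      omega
  refine PLDSymCex.pld_of_bounded (gr (M.disjointSum (Matroid.truncate (Matroid.freeOn (F : Set α)) 6) h)).powerset (fun I : Finset α => ((M.disjointSum (Matroid.truncate (Matroid.freeOn (F : Set α)) 6) h).eRk (I : Set α)).toNat)
    (fun I : Finset α => ((M.disjointSum (Matroid.truncate (Matroid.freeOn (F : Set α)) 6) h).eRk ((gr (M.disjointSum (Matroid.truncate (Matroid.freeOn (F : Set α)) 6) h) \ I : Finset α) : Set α)).toNat) 16 hb ?_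
  intro lo hi δ hlh hhR hδR
  have hL := PLDClosure.sum_powerset_disjointSum M _ h
    (fun x f => if lo ≤ x ∧ x ≤ hi ∧ (if lo = 0 then 0 else lo + hi + δ) ≤ f + x then f.choose δ else 0)
  have hR := PLDClosure.sum_powerset_disjointSum M _ h
    (fun x f => if lo + δ ≤ f ∧ f ≤ hi + δ then f.choose δ else 0)
  beta_reduce at hL hR
  rw [hL, hR]
  have h2L : ∀ x₁ f₁ : ℕ,
      ∑ I₂ ∈ (gr (Matroid.truncate (Matroid.freeOn (F : Set α)) 6)).powerset,
        (if lo ≤ x₁ + ((Matroid.truncate (Matroid.freeOn (F : Set α)) 6).eRk (I₂ : Set α)).toNat ∧ x₁ + ((Matroid.truncate (Matroid.freeOn (F : Set α)) 6).eRk (I₂ : Set α)).toNat ≤ hi ∧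
            (if lo = 0 then 0 else lo + hi + δ) ≤ f₁ + ((Matroid.truncate (Matroid.freeOn (F : Set α)) 6).eRk ((gr (Matroid.truncate (Matroid.freeOn (F : Set α)) 6) \ I₂ : Finset α) : Set α)).toNat +
              (x₁ + ((Matroid.truncate (Matroid.freeOn (F : Set α)) 6).eRk (I₂ : Set α)).toNat) then
          (f₁ + ((Matroid.truncate (Matroid.freeOn (F : Set α)) 6).eRk ((gr (Matroid.truncate (Matroid.freeOn (F : Set α)) 6) \ I₂ : Finset α) : Set α)).toNat).choose δ else 0) =
      (∑ i ∈ range (F.card + 1), Nat.choose F.card i * (if lo ≤ x₁ + min i 6 ∧ x₁ + min i 6 ≤ hi ∧ (if lo = 0 then 0 else lo + hi + δ) ≤ (f₁ + min (F.card - i) 6) + (x₁ + min i 6) then (f₁ + min (F.card - i) 6).choose δ else 0)) := by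
    intro x₁ f₁
    have := PLDTruncate.sum_powerset_truncate_freeOn F 6
      (fun x₂ f₂ => if lo ≤ x₁ + x₂ ∧ x₁ + x₂ ≤ hi ∧ (if lo = 0 then 0 else lo + hi + δ) ≤ f₁ + f₂ + (x₁ + x₂) then
        (f₁ + f₂).choose δ else 0)
    beta_reduce at this
    exact this
  have h2R : ∀ f₁ : ℕ,
      ∑ I₂ ∈ (gr (Matroid.truncate (Matroid.freeOn (F : Set α)) 6)).powerset,
        (if lo + δ ≤ f₁ + ((Matroid.truncate (Matroid.freeOn (F : Set α)) 6).eRk ((gr (Matroid.truncate (Matroid.freeOn (F : Set α)) 6) \ I₂ : Finset α) : Set α)).toNat ∧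
            f₁ + ((Matroid.truncate (Matroid.freeOn (F : Set α)) 6).eRk ((gr (Matroid.truncate (Matroid.freeOn (F : Set α)) 6) \ I₂ : Finset α) : Set α)).toNat ≤ hi + δ then
          (f₁ + ((Matroid.truncate (Matroid.freeOn (F : Set α)) 6).eRk ((gr (Matroid.truncate (Matroid.freeOn (F : Set α)) 6) \ I₂ : Finset α) : Set α)).toNat).choose δ else 0) =
      (∑ i ∈ range (F.card + 1), Nat.choose F.card i * (if lo + δ ≤ f₁ + min (F.card - i) 6 ∧ f₁ + min (F.card - i) 6 ≤ hi + δ then (f₁ + min (F.card - i) 6).choose δ else 0)) := by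
    intro f₁
    have := PLDTruncate.sum_powerset_truncate_freeOn F 6
      (fun x₂ f₂ => if lo + δ ≤ f₁ + f₂ ∧ f₁ + f₂ ≤ hi + δ then (f₁ + f₂).choose δ else 0)
    beta_reduce at this
    exact this
  simp only [h2L, h2R]
  -- the case `m = 12` from the landed table, in 32 δ-parts
  have h4 : ∑ I ∈ (gr M).powerset, (∑ i ∈ range (12 + 1), Nat.choose 12 i * (if lo ≤ (M.eRk (I : Set α)).toNat + min i 6 ∧ (M.eRk (I : Set α)).toNat + min i 6 ≤ hi ∧ (if lo = 0 then 0 else lo + hi + δ) ≤ ((M.eRk ((gr M \ I : Finset α) : Set α)).toNat + min (12 - i) 6) + ((M.eRk (I : Set α)).toNat + min i 6) then ((M.eRk ((gr M \ I : Finset α) : Set α)).toNat + min (12 - i) 6).choose δ else 0)) ≤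
      ∑ I ∈ (gr M).powerset, (∑ i ∈ range (12 + 1), Nat.choose 12 i * (if lo + δ ≤ (M.eRk ((gr M \ I : Finset α) : Set α)).toNat + min (12 - i) 6 ∧ (M.eRk ((gr M \ I : Finset α) : Set α)).toNat + min (12 - i) 6 ≤ hi + δ then ((M.eRk ((gr M \ I : Finset α) : Set α)).toNat + min (12 - i) 6).choose δ else 0)) := by
    rcases Nat.lt_or_ge δ 1 with hδ0 | hδ0
    · obtain ⟨hDpos, hadm, hcert⟩ := PLDTriangle.uniform_6_12_table_10_part0 _ rfl lo (mem_range.2 (by omega)) hi (mem_range.2 (by omega))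
        δ (mem_range.2 (by omega)) hlh
      have key := PLDCert.sum_le_of_cert M hPLD 10 hr' _ hadm _ _ hcert
      rw [← Finset.mul_sum, ← Finset.mul_sum] at key
      exact Nat.le_of_mul_le_mul_left key hDpos
    rcases Nat.lt_or_ge δ 1 with hδ1 | hδ1
    · obtain ⟨hDpos, hadm, hcert⟩ := PLDTriangle.uniform_6_12_table_10_part1 _ rfl lo (mem_range.2 (by omega)) hi (mem_range.2 (by omega))
        δ (mem_Ico.2 ⟨by omega, by omega⟩) hlh
      have key := PLDCert.sum_le_of_cert M hPLD 10 hr' _ hadm _ _ hcert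
      rw [← Finset.mul_sum, ← Finset.mul_sum] at key
      exact Nat.le_of_mul_le_mul_left key hDpos
    rcases Nat.lt_or_ge δ 2 with hδ2 | hδ2
    · obtain ⟨hDpos, hadm, hcert⟩ := PLDTriangle.uniform_6_12_table_10_part2 _ rfl lo (mem_range.2 (by omega)) hi (mem_range.2 (by omega))
        δ (mem_Ico.2 ⟨by omega, by omega⟩) hlh
      have key := PLDCert.sum_le_of_cert M hPLD 10 hr' _ hadm _ _ hcert
      rw [← Finset.mul_sum, ← Finset.mul_sum] at key
      exact Nat.le_of_mul_le_mul_left key hDpos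
    rcases Nat.lt_or_ge δ 2 with hδ3 | hδ3
    · obtain ⟨hDpos, hadm, hcert⟩ := PLDTriangle.uniform_6_12_table_10_part3 _ rfl lo (mem_range.2 (by omega)) hi (mem_range.2 (by omega))
        δ (mem_Ico.2 ⟨by omega, by omega⟩) hlh
      have key := PLDCert.sum_le_of_cert M hPLD 10 hr' _ hadm _ _ hcert
      rw [← Finset.mul_sum, ← Finset.mul_sum] at key
      exact Nat.le_of_mul_le_mul_left key hDpos
    rcases Nat.lt_or_ge δ 3 with hδ4 | hδ4
    · obtain ⟨hDpos, hadm, hcert⟩ := PLDTriangle.uniform_6_12_table_10_part4 _ rfl lo (mem_range.2 (by omega)) hi (mem_range.2 (by omega))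
        δ (mem_Ico.2 ⟨by omega, by omega⟩) hlh
      have key := PLDCert.sum_le_of_cert M hPLD 10 hr' _ hadm _ _ hcert
      rw [← Finset.mul_sum, ← Finset.mul_sum] at key
      exact Nat.le_of_mul_le_mul_left key hDpos
    rcases Nat.lt_or_ge δ 3 with hδ5 | hδ5
    · obtain ⟨hDpos, hadm, hcert⟩ := PLDTriangle.uniform_6_12_table_10_part5 _ rfl lo (mem_range.2 (by omega)) hi (mem_range.2 (by omega))
        δ (mem_Ico.2 ⟨by omega, by omega⟩) hlh
      have key := PLDCert.sum_le_of_cert M hPLD 10 hr' _ hadm _ _ hcert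
      rw [← Finset.mul_sum, ← Finset.mul_sum] at key
      exact Nat.le_of_mul_le_mul_left key hDpos
    rcases Nat.lt_or_ge δ 4 with hδ6 | hδ6
    · obtain ⟨hDpos, hadm, hcert⟩ := PLDTriangle.uniform_6_12_table_10_part6 _ rfl lo (mem_range.2 (by omega)) hi (mem_range.2 (by omega))
        δ (mem_Ico.2 ⟨by omega, by omega⟩) hlh
      have key := PLDCert.sum_le_of_cert M hPLD 10 hr' _ hadm _ _ hcert
      rw [← Finset.mul_sum, ← Finset.mul_sum] at key
      exact Nat.le_of_mul_le_mul_left key hDpos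
    rcases Nat.lt_or_ge δ 4 with hδ7 | hδ7
    · obtain ⟨hDpos, hadm, hcert⟩ := PLDTriangle.uniform_6_12_table_10_part7 _ rfl lo (mem_range.2 (by omega)) hi (mem_range.2 (by omega))
        δ (mem_Ico.2 ⟨by omega, by omega⟩) hlh
      have key := PLDCert.sum_le_of_cert M hPLD 10 hr' _ hadm _ _ hcert
      rw [← Finset.mul_sum, ← Finset.mul_sum] at key
      exact Nat.le_of_mul_le_mul_left key hDpos
    rcases Nat.lt_or_ge δ 5 with hδ8 | hδ8
    · obtain ⟨hDpos, hadm, hcert⟩ := PLDTriangle.uniform_6_12_table_10_part8 _ rfl lo (mem_range.2 (by omega)) hi (mem_range.2 (by omega))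
        δ (mem_Ico.2 ⟨by omega, by omega⟩) hlh
      have key := PLDCert.sum_le_of_cert M hPLD 10 hr' _ hadm _ _ hcert
      rw [← Finset.mul_sum, ← Finset.mul_sum] at key
      exact Nat.le_of_mul_le_mul_left key hDpos
    rcases Nat.lt_or_ge δ 5 with hδ9 | hδ9
    · obtain ⟨hDpos, hadm, hcert⟩ := PLDTriangle.uniform_6_12_table_10_part9 _ rfl lo (mem_range.2 (by omega)) hi (mem_range.2 (by omega))
        δ (mem_Ico.2 ⟨by omega, by omega⟩) hlh
      have key := PLDCert.sum_le_of_cert M hPLD 10 hr' _ hadm _ _ hcert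
      rw [← Finset.mul_sum, ← Finset.mul_sum] at key
      exact Nat.le_of_mul_le_mul_left key hDpos
    rcases Nat.lt_or_ge δ 6 with hδ10 | hδ10
    · obtain ⟨hDpos, hadm, hcert⟩ := PLDTriangle.uniform_6_12_table_10_part10 _ rfl lo (mem_range.2 (by omega)) hi (mem_range.2 (by omega))
        δ (mem_Ico.2 ⟨by omega, by omega⟩) hlh
      have key := PLDCert.sum_le_of_cert M hPLD 10 hr' _ hadm _ _ hcert
      rw [← Finset.mul_sum, ← Finset.mul_sum] at key
      exact Nat.le_of_mul_le_mul_left key hDpos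
    rcases Nat.lt_or_ge δ 6 with hδ11 | hδ11
    · obtain ⟨hDpos, hadm, hcert⟩ := PLDTriangle.uniform_6_12_table_10_part11 _ rfl lo (mem_range.2 (by omega)) hi (mem_range.2 (by omega))
        δ (mem_Ico.2 ⟨by omega, by omega⟩) hlh
      have key := PLDCert.sum_le_of_cert M hPLD 10 hr' _ hadm _ _ hcert
      rw [← Finset.mul_sum, ← Finset.mul_sum] at key
      exact Nat.le_of_mul_le_mul_left key hDpos
    rcases Nat.lt_or_ge δ 7 with hδ12 | hδ12
    · obtain ⟨hDpos, hadm, hcert⟩ := PLDTriangle.uniform_6_12_table_10_part12 _ rfl lo (mem_range.2 (by omega)) hi (mem_range.2 (by omega))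
        δ (mem_Ico.2 ⟨by omega, by omega⟩) hlh
      have key := PLDCert.sum_le_of_cert M hPLD 10 hr' _ hadm _ _ hcert
      rw [← Finset.mul_sum, ← Finset.mul_sum] at key
      exact Nat.le_of_mul_le_mul_left key hDpos
    rcases Nat.lt_or_ge δ 7 with hδ13 | hδ13
    · obtain ⟨hDpos, hadm, hcert⟩ := PLDTriangle.uniform_6_12_table_10_part13 _ rfl lo (mem_range.2 (by omega)) hi (mem_range.2 (by omega))
        δ (mem_Ico.2 ⟨by omega, by omega⟩) hlh
      have key := PLDCert.sum_le_of_cert M hPLD 10 hr' _ hadm _ _ hcert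
      rw [← Finset.mul_sum, ← Finset.mul_sum] at key
      exact Nat.le_of_mul_le_mul_left key hDpos
    rcases Nat.lt_or_ge δ 8 with hδ14 | hδ14
    · obtain ⟨hDpos, hadm, hcert⟩ := PLDTriangle.uniform_6_12_table_10_part14 _ rfl lo (mem_range.2 (by omega)) hi (mem_range.2 (by omega))
        δ (mem_Ico.2 ⟨by omega, by omega⟩) hlh
      have key := PLDCert.sum_le_of_cert M hPLD 10 hr' _ hadm _ _ hcert
      rw [← Finset.mul_sum, ← Finset.mul_sum] at key
      exact Nat.le_of_mul_le_mul_left key hDpos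
    rcases Nat.lt_or_ge δ 8 with hδ15 | hδ15
    · obtain ⟨hDpos, hadm, hcert⟩ := PLDTriangle.uniform_6_12_table_10_part15 _ rfl lo (mem_range.2 (by omega)) hi (mem_range.2 (by omega))
        δ (mem_Ico.2 ⟨by omega, by omega⟩) hlh
      have key := PLDCert.sum_le_of_cert M hPLD 10 hr' _ hadm _ _ hcert
      rw [← Finset.mul_sum, ← Finset.mul_sum] at key
      exact Nat.le_of_mul_le_mul_left key hDpos
    rcases Nat.lt_or_ge δ 9 with hδ16 | hδ16
    · obtain ⟨hDpos, hadm, hcert⟩ := PLDTriangle.uniform_6_12_table_10_part16 _ rfl lo (mem_range.2 (by omega)) hi (mem_range.2 (by omega))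
        δ (mem_Ico.2 ⟨by omega, by omega⟩) hlh
      have key := PLDCert.sum_le_of_cert M hPLD 10 hr' _ hadm _ _ hcert
      rw [← Finset.mul_sum, ← Finset.mul_sum] at key
      exact Nat.le_of_mul_le_mul_left key hDpos
    rcases Nat.lt_or_ge δ 10 with hδ17 | hδ17
    · obtain ⟨hDpos, hadm, hcert⟩ := PLDTriangle.uniform_6_12_table_10_part17 _ rfl lo (mem_range.2 (by omega)) hi (mem_range.2 (by omega))
        δ (mem_Ico.2 ⟨by omega, by omega⟩) hlh
      have key := PLDCert.sum_le_of_cert M hPLD 10 hr' _ hadm _ _ hcert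
      rw [← Finset.mul_sum, ← Finset.mul_sum] at key
      exact Nat.le_of_mul_le_mul_left key hDpos
    rcases Nat.lt_or_ge δ 10 with hδ18 | hδ18
    · obtain ⟨hDpos, hadm, hcert⟩ := PLDTriangle.uniform_6_12_table_10_part18 _ rfl lo (mem_range.2 (by omega)) hi (mem_range.2 (by omega))
        δ (mem_Ico.2 ⟨by omega, by omega⟩) hlh
      have key := PLDCert.sum_le_of_cert M hPLD 10 hr' _ hadm _ _ hcert
      rw [← Finset.mul_sum, ← Finset.mul_sum] at key
      exact Nat.le_of_mul_le_mul_left key hDpos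
    rcases Nat.lt_or_ge δ 11 with hδ19 | hδ19
    · obtain ⟨hDpos, hadm, hcert⟩ := PLDTriangle.uniform_6_12_table_10_part19 _ rfl lo (mem_range.2 (by omega)) hi (mem_range.2 (by omega))
        δ (mem_Ico.2 ⟨by omega, by omega⟩) hlh
      have key := PLDCert.sum_le_of_cert M hPLD 10 hr' _ hadm _ _ hcert
      rw [← Finset.mul_sum, ← Finset.mul_sum] at key
      exact Nat.le_of_mul_le_mul_left key hDpos
    rcases Nat.lt_or_ge δ 11 with hδ20 | hδ20
    · obtain ⟨hDpos, hadm, hcert⟩ := PLDTriangle.uniform_6_12_table_10_part20 _ rfl lo (mem_range.2 (by omega)) hi (mem_range.2 (by omega))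
        δ (mem_Ico.2 ⟨by omega, by omega⟩) hlh
      have key := PLDCert.sum_le_of_cert M hPLD 10 hr' _ hadm _ _ hcert
      rw [← Finset.mul_sum, ← Finset.mul_sum] at key
      exact Nat.le_of_mul_le_mul_left key hDpos
    rcases Nat.lt_or_ge δ 12 with hδ21 | hδ21
    · obtain ⟨hDpos, hadm, hcert⟩ := PLDTriangle.uniform_6_12_table_10_part21 _ rfl lo (mem_range.2 (by omega)) hi (mem_range.2 (by omega))
        δ (mem_Ico.2 ⟨by omega, by omega⟩) hlh
      have key := PLDCert.sum_le_of_cert M hPLD 10 hr' _ hadm _ _ hcert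
      rw [← Finset.mul_sum, ← Finset.mul_sum] at key
      exact Nat.le_of_mul_le_mul_left key hDpos
    rcases Nat.lt_or_ge δ 12 with hδ22 | hδ22
    · obtain ⟨hDpos, hadm, hcert⟩ := PLDTriangle.uniform_6_12_table_10_part22 _ rfl lo (mem_range.2 (by omega)) hi (mem_range.2 (by omega))
        δ (mem_Ico.2 ⟨by omega, by omega⟩) hlh
      have key := PLDCert.sum_le_of_cert M hPLD 10 hr' _ hadm _ _ hcert
      rw [← Finset.mul_sum, ← Finset.mul_sum] at key
      exact Nat.le_of_mul_le_mul_left key hDpos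
    rcases Nat.lt_or_ge δ 13 with hδ23 | hδ23
    · obtain ⟨hDpos, hadm, hcert⟩ := PLDTriangle.uniform_6_12_table_10_part23 _ rfl lo (mem_range.2 (by omega)) hi (mem_range.2 (by omega))
        δ (mem_Ico.2 ⟨by omega, by omega⟩) hlh
      have key := PLDCert.sum_le_of_cert M hPLD 10 hr' _ hadm _ _ hcert
      rw [← Finset.mul_sum, ← Finset.mul_sum] at key
      exact Nat.le_of_mul_le_mul_left key hDpos
    rcases Nat.lt_or_ge δ 13 with hδ24 | hδ24
    · obtain ⟨hDpos, hadm, hcert⟩ := PLDTriangle.uniform_6_12_table_10_part24 _ rfl lo (mem_range.2 (by omega)) hi (mem_range.2 (by omega))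
        δ (mem_Ico.2 ⟨by omega, by omega⟩) hlh
      have key := PLDCert.sum_le_of_cert M hPLD 10 hr' _ hadm _ _ hcert
      rw [← Finset.mul_sum, ← Finset.mul_sum] at key
      exact Nat.le_of_mul_le_mul_left key hDpos
    rcases Nat.lt_or_ge δ 14 with hδ25 | hδ25
    · obtain ⟨hDpos, hadm, hcert⟩ := PLDTriangle.uniform_6_12_table_10_part25 _ rfl lo (mem_range.2 (by omega)) hi (mem_range.2 (by omega))
        δ (mem_Ico.2 ⟨by omega, by omega⟩) hlh
      have key := PLDCert.sum_le_of_cert M hPLD 10 hr' _ hadm _ _ hcert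
      rw [← Finset.mul_sum, ← Finset.mul_sum] at key
      exact Nat.le_of_mul_le_mul_left key hDpos
    rcases Nat.lt_or_ge δ 14 with hδ26 | hδ26
    · obtain ⟨hDpos, hadm, hcert⟩ := PLDTriangle.uniform_6_12_table_10_part26 _ rfl lo (mem_range.2 (by omega)) hi (mem_range.2 (by omega))
        δ (mem_Ico.2 ⟨by omega, by omega⟩) hlh
      have key := PLDCert.sum_le_of_cert M hPLD 10 hr' _ hadm _ _ hcert
      rw [← Finset.mul_sum, ← Finset.mul_sum] at key
      exact Nat.le_of_mul_le_mul_left key hDpos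
    rcases Nat.lt_or_ge δ 15 with hδ27 | hδ27
    · obtain ⟨hDpos, hadm, hcert⟩ := PLDTriangle.uniform_6_12_table_10_part27 _ rfl lo (mem_range.2 (by omega)) hi (mem_range.2 (by omega))
        δ (mem_Ico.2 ⟨by omega, by omega⟩) hlh
      have key := PLDCert.sum_le_of_cert M hPLD 10 hr' _ hadm _ _ hcert
      rw [← Finset.mul_sum, ← Finset.mul_sum] at key
      exact Nat.le_of_mul_le_mul_left key hDpos
    rcases Nat.lt_or_ge δ 15 with hδ28 | hδ28
    · obtain ⟨hDpos, hadm, hcert⟩ := PLDTriangle.uniform_6_12_table_10_part28 _ rfl lo (mem_range.2 (by omega)) hi (mem_range.2 (by omega))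
        δ (mem_Ico.2 ⟨by omega, by omega⟩) hlh
      have key := PLDCert.sum_le_of_cert M hPLD 10 hr' _ hadm _ _ hcert
      rw [← Finset.mul_sum, ← Finset.mul_sum] at key
      exact Nat.le_of_mul_le_mul_left key hDpos
    rcases Nat.lt_or_ge δ 16 with hδ29 | hδ29
    · obtain ⟨hDpos, hadm, hcert⟩ := PLDTriangle.uniform_6_12_table_10_part29 _ rfl lo (mem_range.2 (by omega)) hi (mem_range.2 (by omega))
        δ (mem_Ico.2 ⟨by omega, by omega⟩) hlh
      have key := PLDCert.sum_le_of_cert M hPLD 10 hr' _ hadm _ _ hcert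
      rw [← Finset.mul_sum, ← Finset.mul_sum] at key
      exact Nat.le_of_mul_le_mul_left key hDpos
    rcases Nat.lt_or_ge δ 16 with hδ30 | hδ30
    · obtain ⟨hDpos, hadm, hcert⟩ := PLDTriangle.uniform_6_12_table_10_part30 _ rfl lo (mem_range.2 (by omega)) hi (mem_range.2 (by omega))
        δ (mem_Ico.2 ⟨by omega, by omega⟩) hlh
      have key := PLDCert.sum_le_of_cert M hPLD 10 hr' _ hadm _ _ hcert
      rw [← Finset.mul_sum, ← Finset.mul_sum] at key
      exact Nat.le_of_mul_le_mul_left key hDpos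
    obtain ⟨hDpos, hadm, hcert⟩ := PLDTriangle.uniform_6_12_table_10_part31 _ rfl lo (mem_range.2 (by omega)) hi (mem_range.2 (by omega))
      δ (mem_Ico.2 ⟨by omega, by omega⟩) hlh
    have key := PLDCert.sum_le_of_cert M hPLD 10 hr' _ hadm _ _ hcert
    rw [← Finset.mul_sum, ← Finset.mul_sum] at key
    exact Nat.le_of_mul_le_mul_left key hDpos
  -- the lift to `m = |F| ≥ 12`
  have hq := PLDPlaneTable.pld_conv_q61_of_eRank_le_10 M hr hPLD lo hi δ hlh hhR hδR
  have hq' := PLDPlaneTable.pld_conv_q62_of_eRank_le_10 M hr hPLD lo hi δ hlh hhR hδR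
  have hq'' := PLDPlaneTable.pld_conv_q63_of_eRank_le_10 M hr hPLD lo hi δ hlh hhR hδR
  have hq''' := PLDPlaneTable.pld_conv_q64n_of_eRank_le_10 M hr hPLD lo hi δ hlh hhR hδR
  exact lift_instance_six_nine (gr M).powerset (fun I : Finset α => (M.eRk (I : Set α)).toNat)
    (fun I : Finset α => (M.eRk ((gr M \ I : Finset α) : Set α)).toNat) hPLD F.card hF lo hi δ
    (if lo = 0 then 0 else lo + hi + δ) (by split_ifs <;> omega) (by split_ifs <;> omega)
    (by simpa only [mul_add, add_assoc, one_mul] using hq) (by simpa only [mul_add, add_assoc, one_mul] using hq') (by simpa only [mul_add, add_assoc, one_mul] using hq'') (by simpa only [mul_add, add_assoc, one_mul] using hq''') h4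

end PLDSixLift

end PercRepro
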